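import Mathlib
import HarnessLib
import Summits.HubbardSuperconductivity.HubbardSuperconductivity.Theorems.KLProgrammeFermiSurfaceSharpTransversal

/-!
# Route `KLProgramme` / `WeakCouplingBCS` — risk-register item r2: the SHARP `BandBounds` bundle with Lean-certified NUMBERS on the
# EXTENDED certificate window `μ ∈ [-0.5725, -0.075]` (cert-2's `δ ∈ [0.05, 0.25]`)

Cell `gate-hubbard-kl`, seat fs-1 (g6); companion of `KLProgrammeFermiSurfaceExtWindow.lean`. Numeric corollaries of
`klfs_exists_sharpBandBounds` (`KLProgrammeFermiSurfaceSharpRange.lean`) at `a = -0.5725`, `b = -0.075`, with the exact radial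
transversality constant of `KLProgrammeFermiSurfaceSharpTransversal.lean`: the transcendental inputs are `d_a = arccos(0.143125) ≥ 1.427`
(from `cos 1.427 = sin(π/2 - 1.427) > 0.1433`), `sin d_a = √(1 - 0.143125²) ≤ 0.9898`, and `K_b = arccos(-0.9625) ≤ 2.868` (half-angle square
of the quadratic cosine minorant: `cos x ≥ 2(1 - x²/8)² - 1 > 0.9627` at `x = π - 2.868`); everything else is rational arithmetic with `√2`,
`√(-μ(4+μ))`, `√(32 - 2b²)`. Result (`klfs_xwin_sharpBandBounds`): a `BandBounds (-0.5725) (-0.075)` with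
  `umin ≥ 2.018`, `smax ≤ 4.06`, `A2 ≤ 51.1`, `hmin ≥ 0.0778`, `amin ≥ 0.0267`, `rhomin ≥ 0.2712`, `cmax ≤ 0.694`,
  `Dtmin ≥ 0.5424` (`= 2 s_b`, exact), **`C_g ≤ 556`**, `Dcell ≤ 3.88`
(certified sharp values, kit j257184, two interval implementations, FS-WINDOW.md §9: `2.0183`, `4.0544`, `50.955`, `0.077951`, `0.026764`,
`0.27128`, `0.69347`, `0.54256`, `553.03`, `3.870`; vs the doping window `[-0.4275, -0.1775]`: `C_g` 96.75 → 553, `A2` 33.0 → 51.0,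
`h_min` 0.192 → 0.078, `Dt_min` 0.824 → 0.543 — the price of `δ = 0.05`). Also `∂ₜF ≥ 0.5424` at every level of the window
(`klfs_xwin_rayDispersionDt_ge`). No definitions; everything PROVED. [folklore]
-/
noncomputable section

open Real Set

-- the tree's namespace `Summit.<Summit>.<Problem>.Theorems` repeats the summit name by design (D-0017)
set_option linter.dupNamespace false

namespace Summit.HubbardSuperconductivity.HubbardSuperconductivity.Theorems

open Literature.MathematicalPhysics.QuantumLattice
open Literature.MathematicalPhysics.QuantumLattice.BandSectorCounting

/-! ### §1 The numeric inputs at `a = -0.5725`, `b = -0.075` -/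

/-- **`d_a = arccos(0.143125) ≥ 1.427`** (`cos 1.427 = sin(π/2 - 1.427) > 0.1433 > 0.143125`). [folklore] -/
theorem klfs_numX_arccos_da_ge : (1.427 : ℝ) ≤ Real.arccos (-(-0.5725 : ℝ) / 4) := by
  have hπ1 := Real.pi_gt_d6
  have hπ2 := Real.pi_lt_d6
  set x : ℝ := π / 2 - 1.427 with hx
  have hx1 : (0.143796 : ℝ) ≤ x := by rw [hx]; linarith
  have hx2 : x ≤ (0.143797 : ℝ) := by rw [hx]; linarith
  have hx0 : 0 < x := by linarith
  have hsin : x - x ^ 3 / 6 < Real.sin x := Real.sin_gt_sub_cube hx0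
  have hx3 : x ^ 3 ≤ (0.143797 : ℝ) ^ 3 := pow_le_pow_left₀ hx0.le hx2 3
  have hcos : Real.cos 1.427 = Real.sin x := by rw [hx, Real.sin_pi_div_two_sub]
  have hval : (-(-0.5725 : ℝ) / 4) ≤ Real.cos 1.427 := by rw [hcos]; norm_num at hx3 ⊢; linarith
  have h := Real.antitone_arccos hval
  rwa [Real.arccos_cos (by norm_num) (by linarith)] at h

/-- `d_a ≤ π/2 < 1.5708`. [folklore] -/
theorem klfs_numX_arccos_da_le : Real.arccos (-(-0.5725 : ℝ) / 4) ≤ 1.5708 := by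
  have h := Real.arccos_lt_pi_div_two.2 (show (0 : ℝ) < -(-0.5725 : ℝ) / 4 by norm_num)
  have hπ2 := Real.pi_lt_d6
  linarith

/-- **`K_b = arccos(-0.9625) ≤ 2.868`** (`cos(π - 2.868) ≥ 2(1 - (π - 2.868)²/8)² - 1 > 0.9627`, the half-angle square of
the quadratic cosine minorant). [folklore] -/
theorem klfs_numX_umklappRadius_b_le : umklappRadius (-0.075) ≤ 2.868 := by
  have hπ1 := Real.pi_gt_d6
  have hπ2 := Real.pi_lt_d6
  set x : ℝ := π - 2.868 with hx
  have hx1 : (0.273592 : ℝ) ≤ x := by rw [hx]; linarith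
  have hx2 : x ≤ (0.273593 : ℝ) := by rw [hx]; linarith
  have hh : 1 - (x / 2) ^ 2 / 2 ≤ Real.cos (x / 2) := Real.one_sub_sq_div_two_le_cos
  have hh0 : 0 ≤ 1 - (x / 2) ^ 2 / 2 := by nlinarith
  have hsq : (1 - (x / 2) ^ 2 / 2) ^ 2 ≤ Real.cos (x / 2) ^ 2 := pow_le_pow_left₀ hh0 hh 2
  have hdouble : Real.cos x = 2 * Real.cos (x / 2) ^ 2 - 1 := by
    have h := Real.cos_sq (x / 2)
    rw [show 2 * (x / 2) = x by ring] at h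
    linarith
  have hx22 : x ^ 2 ≤ (0.273593 : ℝ) ^ 2 := pow_le_pow_left₀ (by linarith) hx2 2
  have hcx : (0.9627 : ℝ) ≤ Real.cos x := by rw [hdouble]; nlinarith
  have hcos : Real.cos 2.868 = -Real.cos x := by
    rw [hx, Real.cos_pi_sub, neg_neg]
  have hval : Real.cos 2.868 ≤ -(-0.075 : ℝ) / 2 - 1 := by rw [hcos]; linarith
  have h := Real.antitone_arccos hval
  rw [Real.arccos_cos (by norm_num) (by linarith)] at h
  exact h

/-- `0.2712 ≤ s_* = min(s_a, s_b) ≤ s_b ≤ 0.2713` on the extended window (`s_μ = √(-μ(4+μ))/2`; `s_a ≈ 0.70`). [folklore] -/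
theorem klfs_numX_levelSin_min :
    (0.2712 : ℝ) ≤ min (Real.sqrt (-(-0.5725 : ℝ) * (4 + -0.5725)) / 2) (Real.sqrt (-(-0.075 : ℝ) * (4 + -0.075)) / 2) ∧
    min (Real.sqrt (-(-0.5725 : ℝ) * (4 + -0.5725)) / 2) (Real.sqrt (-(-0.075 : ℝ) * (4 + -0.075)) / 2) ≤ 0.2713 := by
  have ha : (0.7 : ℝ) ≤ Real.sqrt (-(-0.5725 : ℝ) * (4 + -0.5725)) / 2 := by
    rw [le_div_iff₀ (by norm_num : (0:ℝ) < 2), Real.le_sqrt (by norm_num) (by norm_num)]; norm_num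
  have hb : (0.2712 : ℝ) ≤ Real.sqrt (-(-0.075 : ℝ) * (4 + -0.075)) / 2 := by
    rw [le_div_iff₀ (by norm_num : (0:ℝ) < 2), Real.le_sqrt (by norm_num) (by norm_num)]; norm_num
  have hb' : Real.sqrt (-(-0.075 : ℝ) * (4 + -0.075)) / 2 ≤ 0.2713 := by
    rw [div_le_iff₀ (by norm_num : (0:ℝ) < 2), Real.sqrt_le_left (by norm_num)]; norm_num
  exact ⟨le_min (by linarith) hb, (min_le_right _ _).trans hb'⟩

/-- `0.01326 ≤ κ_b = 0.075/√(32 - 2·0.075²)`. [folklore] -/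
theorem klfs_numX_kappa_b_ge : (0.01326 : ℝ) ≤ -(-0.075 : ℝ) / Real.sqrt (32 - 2 * (-0.075 : ℝ) ^ 2) := by
  have hs : Real.sqrt (32 - 2 * (-0.075 : ℝ) ^ 2) ≤ 5.6559 := by
    rw [Real.sqrt_le_left (by norm_num)]; norm_num
  have hs0 : 0 < Real.sqrt (32 - 2 * (-0.075 : ℝ) ^ 2) := Real.sqrt_pos.2 (by norm_num)
  rw [le_div_iff₀ hs0]
  nlinarith

/-- `0.03748 ≤ min(n_a, n_b)` (`n_μ = (-μ/2)(1 - μ²/16)`; `n_a = 0.2804`, the minimum is `n_b = 0.037487`). [folklore] -/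
theorem klfs_numX_levelN_min_ge :
    (0.03748 : ℝ) ≤ min (-(-0.5725 : ℝ) / 2 * (1 - (-0.5725 : ℝ) ^ 2 / 16)) (-(-0.075 : ℝ) / 2 * (1 - (-0.075 : ℝ) ^ 2 / 16)) :=
  le_min (by norm_num) (by norm_num)

/-- **`sin d_a = √(1 - 0.143125²) ≤ 0.9898`**. [folklore] -/
theorem klfs_numX_sin_da_le : Real.sin (Real.arccos (-(-0.5725 : ℝ) / 4)) ≤ 0.9898 := by
  rw [Real.sin_arccos, Real.sqrt_le_left (by norm_num)]
  norm_num

/-- `sin d_a / d_a ≤ 0.9898/1.427 < 0.694`. [folklore] -/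
theorem klfs_numX_sinc_da_le : Real.sin (Real.arccos (-(-0.5725 : ℝ) / 4)) / Real.arccos (-(-0.5725 : ℝ) / 4) ≤ 0.694 := by
  have hd := klfs_numX_arccos_da_ge
  have hd0 : 0 < Real.arccos (-(-0.5725 : ℝ) / 4) := by linarith
  rw [div_le_iff₀ hd0]
  have := klfs_numX_sin_da_le
  nlinarith

/-- `0 < sin d_a / d_a`. [folklore] -/
theorem klfs_numX_sinc_da_pos : 0 < Real.sin (Real.arccos (-(-0.5725 : ℝ) / 4)) / Real.arccos (-(-0.5725 : ℝ) / 4) := by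
  have hd := klfs_numX_arccos_da_ge
  have hdle := klfs_numX_arccos_da_le
  have hd0 : 0 < Real.arccos (-(-0.5725 : ℝ) / 4) := by linarith
  exact div_pos (Real.sin_pos_of_pos_of_lt_pi hd0 (by linarith [Real.pi_gt_d6])) hd0

/-! ### §2 Radial transversality and the bundle -/

/-- **`∂ₜF ≥ 0.5424` on the extended window** (`= 2 s_b`, exact radial transversality; `sin(√2 d_a) ≥ 0.585` and
`sin K_b = s_b ≥ 0.2712`). [folklore] -/
theorem klfs_xwin_rayDispersionDt_ge {μ : ℝ} (hμ : μ ∈ Icc (-0.5725 : ℝ) (-0.075)) (θ : ℝ) :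
    (0.5424 : ℝ) ≤ rayDispersionDt θ (bandFermiRadius μ θ) := by
  have h := klfs_rayDispersionDt_ge_range (a := -0.5725) (b := -0.075) (by norm_num) (by norm_num) (by norm_num) hμ θ
  have hs : (0.2712 : ℝ) ≤ Real.sin (umklappRadius (-0.075)) := by
    rw [klfs_sin_umklappRadius (by norm_num) (by norm_num), le_div_iff₀ (by norm_num : (0:ℝ) < 2),
      Real.le_sqrt (by norm_num) (by norm_num)]
    norm_num
  have hp : (0.585 : ℝ) ≤ Real.sin (Real.sqrt 2 * Real.arccos (-(-0.5725 : ℝ) / 4)) :=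
    klfs_num_sin_sqrt_two_mul_ge (by linarith [klfs_numX_arccos_da_ge]) klfs_numX_arccos_da_le
  have hmin : (0.2712 : ℝ) ≤ min (Real.sin (Real.sqrt 2 * Real.arccos (-(-0.5725 : ℝ) / 4)))
      (Real.sin (umklappRadius (-0.075))) := le_min (by linarith) hs
  linarith

/-- **The SHARP bundle on the EXTENDED window `μ ∈ [-0.5725, -0.075]` (cert-2's `δ ∈ [0.05, 0.25]`) with its constants as
numbers and the exact transversality constant**: a `BandBounds (-0.5725) (-0.075)` with `umin ≥ 2.018`, `smax ≤ 4.06`, `A2 ≤ 51.1`,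
`hmin ≥ 0.0778`, `amin ≥ 0.0267`, `rhomin ≥ 0.2712`, `cmax ≤ 0.694`, `Dtmin ≥ 0.5424`, `C_g ≤ 556`, `Dcell ≤ 3.88`
(certified sharp values, kit j257184: `2.0183, 4.0544, 50.955, 0.077951, 0.026764, 0.27128, 0.69347, 0.54256, 553.03, 3.870`;
the tree's generic `bandBounds` on the same range: `C_g ≈ 9.0·10⁵`, `A2 ≈ 3 240`, `smax ≈ 26`).
[folklore] -/
theorem klfs_xwin_sharpBandBounds :
    ∃ B : BandBounds (-0.5725) (-0.075),
      2.018 ≤ B.umin ∧ B.smax ≤ 4.06 ∧ B.A2 ≤ 51.1 ∧ 0.0778 ≤ B.hmin ∧ 0.0267 ≤ B.amin ∧ 0.2712 ≤ B.rhomin ∧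
      B.cmax ≤ 0.694 ∧ 0.5424 ≤ B.Dtmin ∧ B.Cg ≤ 556 ∧ B.Dcell ≤ 3.88 := by
  obtain ⟨B₀, hu, hs, hA, hh, ham, hr, hc, -⟩ :=
    klfs_exists_sharpBandBounds (a := -0.5725) (b := -0.075) (by norm_num) (by norm_num) (by norm_num)
  obtain ⟨h2l, h2u⟩ := klfs_num_sqrt_two
  have hd := klfs_numX_arccos_da_ge
  have hK := klfs_numX_umklappRadius_b_le
  have hK0 : 0 < umklappRadius (-0.075) := umklappRadius_pos (by norm_num)
  obtain ⟨hsl, hsu⟩ := klfs_numX_levelSin_min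
  have hκ := klfs_numX_kappa_b_ge
  have hn := klfs_numX_levelN_min_ge
  have hsinc := klfs_numX_sinc_da_le
  have hsinc0 := klfs_numX_sinc_da_pos
  -- the seven fields kept from the closed-form bundle
  have e_umin : 2.018 ≤ B₀.umin := by
    rw [hu]
    calc (2.018 : ℝ) ≤ 1.41421 * 1.427 := by norm_num
      _ ≤ Real.sqrt 2 * Real.arccos (-(-0.5725 : ℝ) / 4) := mul_le_mul h2l hd (by norm_num) (Real.sqrt_nonneg 2)
  have e_smax : B₀.smax ≤ 4.06 := by
    rw [hs]
    calc Real.sqrt 2 * umklappRadius (-0.075) ≤ 1.41422 * 2.868 := mul_le_mul h2u hK hK0.le (by norm_num)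
      _ ≤ 4.06 := by norm_num
  have e_A2 : B₀.A2 ≤ 51.1 := by
    rw [hA]
    have h1 : umklappRadius (-0.075) ^ 2 /
        min (Real.sqrt (-(-0.5725 : ℝ) * (4 + -0.5725)) / 2) (Real.sqrt (-(-0.075 : ℝ) * (4 + -0.075)) / 2) ≤
        2.868 ^ 2 / 0.2712 :=
      (div_le_div_of_nonneg_right (pow_le_pow_left₀ hK0.le hK 2) (by linarith)).trans
        (div_le_div_of_nonneg_left (by norm_num) (by norm_num) hsl)
    have h3 : 0 ≤ umklappRadius (-0.075) ^ 2 /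
        min (Real.sqrt (-(-0.5725 : ℝ) * (4 + -0.5725)) / 2) (Real.sqrt (-(-0.075 : ℝ) * (4 + -0.075)) / 2) +
        2 * umklappRadius (-0.075) := by positivity
    calc Real.sqrt 2 * (umklappRadius (-0.075) ^ 2 /
          min (Real.sqrt (-(-0.5725 : ℝ) * (4 + -0.5725)) / 2) (Real.sqrt (-(-0.075 : ℝ) * (4 + -0.075)) / 2) +
          2 * umklappRadius (-0.075))
        ≤ 1.41422 * (2.868 ^ 2 / 0.2712 + 2 * 2.868) := mul_le_mul h2u (by linarith) h3 (by norm_num)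
      _ ≤ 51.1 := by norm_num
  have e_hmin : 0.0778 ≤ B₀.hmin := by
    rw [hh, le_div_iff₀ (pow_pos hsinc0 2)]
    have h1 : (Real.sin (Real.arccos (-(-0.5725 : ℝ) / 4)) / Real.arccos (-(-0.5725 : ℝ) / 4)) ^ 2 ≤ 0.694 ^ 2 :=
      pow_le_pow_left₀ hsinc0.le hsinc 2
    calc (0.0778 : ℝ) * (Real.sin (Real.arccos (-(-0.5725 : ℝ) / 4)) / Real.arccos (-(-0.5725 : ℝ) / 4)) ^ 2
        ≤ 0.0778 * 0.694 ^ 2 := mul_le_mul_of_nonneg_left h1 (by norm_num)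
      _ ≤ 0.03748 := by norm_num
      _ ≤ _ := hn
  have e_amin : 0.0267 ≤ B₀.amin := by
    rw [ham]
    calc (0.0267 : ℝ) ≤ 0.01326 * (1.41421 * 1.427) := by norm_num
      _ ≤ _ := mul_le_mul hκ (mul_le_mul h2l hd (by norm_num) (Real.sqrt_nonneg 2)) (by norm_num) (by linarith)
  have e_rhomin : 0.2712 ≤ B₀.rhomin := by rw [hr]; exact hsl
  have e_cmax : B₀.cmax ≤ 0.694 := by rw [hc]; exact hsinc
  -- the exact transversality constant replaces the closed-form `Dtmin`
  have hDt : ∀ μ ∈ Icc (-0.5725 : ℝ) (-0.075), ∀ θ : ℝ, (0.5424 : ℝ) ≤ rayDispersionDt θ (bandFermiRadius μ θ) :=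
    fun μ hμ θ => klfs_xwin_rayDispersionDt_ge hμ θ
  refine ⟨{ B₀ with Dtmin := 0.5424, Dtmin_pos := by norm_num, Dt_ge := hDt }, e_umin, e_smax, e_A2, e_hmin, e_amin,
    e_rhomin, e_cmax, le_rfl, ?_, ?_⟩
  · show π * B₀.cmax / (2 * B₀.amin * B₀.rhomin ^ 2) ≤ 556
    have hπ := Real.pi_lt_d4
    have hBa : 0 < B₀.amin := B₀.amin_pos
    have hBr : 0 < B₀.rhomin := B₀.rhomin_pos
    rw [div_le_iff₀ (by positivity)]
    have h1 : π * B₀.cmax ≤ 3.1416 * 0.694 := mul_le_mul hπ.le e_cmax B₀.cmax_pos.le (by norm_num)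
    have h2 : (0.0267 : ℝ) * 0.2712 ^ 2 ≤ B₀.amin * B₀.rhomin ^ 2 :=
      mul_le_mul e_amin (pow_le_pow_left₀ (by norm_num) e_rhomin 2) (by norm_num) hBa.le
    have h3 : 556 * (2 * B₀.amin * B₀.rhomin ^ 2) = 1112 * (B₀.amin * B₀.rhomin ^ 2) := by ring
    rw [h3]
    linarith
  · show 1 / (0.5424 : ℝ) + B₀.smax / 2 ≤ 3.88
    have : (1 : ℝ) / 0.5424 ≤ 1.8437 := by norm_num
    linarith

end Summit.HubbardSuperconductivity.HubbardSuperconductivity.Theorems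

end
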